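import Literature.MathematicalPhysics.QuantumFieldTheory.BalabanImbrieJaffe1984to88.BIJ88SlotFactorsShell309
import Literature.MathematicalPhysics.QuantumFieldTheory.BalabanImbrieJaffe1984to88.BIJ88ChiFieldDeriv307
import Literature.Analysis.Calculus.MixedPartialDerivWithin

/-!
# `BalabanImbrieJaffe1984to88.BIJ88ChiMixedDerivN309` — T. Bałaban, J. Imbrie, A. Jaffe, *Effective action and cluster properties of
the abelian Higgs model*, Commun. Math. Phys. **114** (1988) 257–315 [BalabanImbrieJaffe1988]: p. 307 [PDF 51] (Sect. 5.13) and p. 309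
[PDF 53] (Sect. 5.14) — **THE SIZE OF A MIXED t/FIELD-DERIVATIVE OF AN INTERPOLATED χ-FACTOR**.  Print bounds the two kinds of
derivatives of the χ-factors `χ(c·p(te_k), A)` of the decoupling expansion separately: p. 309, *"the n-th derivative in t of
χ(cp(e_k), A^{(k)}) is bounded by t^{−n} times a function bounded by a constant and supported in c₁p(te_k) ≤ |A^{(k)}| ≤ c₂p(te_k)"*
(kernel-checked as `BIJ88ChiTDerivN309`), and p. 307, *"Functional derivatives hitting χ-factors … These derivatives are supported at
|A^{(k)″}| ≥ cp(e_k) … (Factorials can be produced when many functional derivatives hit the same object, for example a characteristic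
function.)"* (kernel-checked, with the scaling `∂ⁿ_x χ(q,x) = q^{−n}χ^{(n)}(1,x/q)`, as `BIJ88ChiFieldDeriv307`).  In the located (5.14.4)
by print's route (p. 309: *"The proof of this estimate is similar to the one for g₂"* — integration by parts in EVERY cube, Sect. 5.13)
the functional derivatives produced by the trains of (5.13.3) land on χ-factors that are ALREADY differentiated in `t`; THIS FILE proves
the joint quantitative statement the two sentences combine to:

  `|∂ⁿ_A ∂^m_t χ(c·p(te_k), A)| ≤ C(χ,p,m,n) · t^{−m} · (|c|·p(te_k))^{−n}`,   vanishing unless `(9/10)|c|p(te_k) ≤ |A| ≤ |c|p(te_k)`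

(`(m,n) ≠ (0,0)` for the support clause), for `c ≠ 0`, `0 < e_k`, `0 < t`, `te_k ≤ e^{−1}` — one `t^{−1}` per t-derivative (p. 309) and
one inverse threshold `(cp(te_k))^{−1}` per field derivative (p. 307 with (5.2.4)), on the shell.  MECHANISM: the mixed partials of the
jointly smooth `(A, s) ↦ χ(1, A/(c·p(se_k)))` commute (Schwarz, all orders: the tree's `Literature.Analysis.Calculus.
iteratedDeriv_iteratedDerivWithin_comm`); the field derivatives act first by scaling, `∂ⁿ_A χ(1, A/q_s) = q_s^{−n} χ^{(n)}(1, A/q_s)`; on the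
shell `A ≠ 0` and `q_s^{−n} χ^{(n)}(1, A/q_s) = A^{−n} ψ_n(A/q_s)` with the smooth compactly supported profile `ψ_n(y) = yⁿχ^{(n)}(1,y)`, so
the `m` t-derivatives fall on `s ↦ ψ_n(A/(c·p(se_k)))` and are bounded by `C·t^{−m}` by the Faà di Bruno route of `BIJ88ChiTDerivN309`
(inner bounds `|∂ⁱ_t[A/(c·p(te_k))]| ≤ M_i t^{−i}|A/(c·p(te_k))|`), while `|A|^{−n} ≤ ((10/9)/(|c|p(te_k)))ⁿ` on the shell.

statement-level skeleton of published theorems with citation tags; proofs where landed; nothing here is a claim about the Yang–Mills mass gap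

PDF held: `paper:balaban1988-cmp114-bij-abelian-higgs-effective-action` (journal page = PDF page + 256); pages re-read this session as text:
PDF 51 (p. 307) L5–8 and L16–18, PDF 53 (p. 309) L21–28 (`lit read … --pages 51-53`).

CITATION HEADER (lean-in-tree rule).  Part of the lit-balaban TYPED SKELETON (HOME `run/shared/lean/pub/lit-balaban/`), Phase 2, seat p36
(gen 21, unit `lit-balaban-p36`); row **C2.Eq5.14.3-5.14.4** of `HOME/lit-balaban-r16/ROWS-C2-part2.md` (member: §f brick 5 — the SIZE of
what a train's field derivative costs when it lands on a t-differentiated χ-slot of the located cube product; companions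
`BIJ88SlotFactorsSmooth308` (typing), `BIJ88SlotFactorsShell309` (support), `BIJ88CubeProductFDeriv306` (where the derivative lands)).
WHAT IS REPRODUCED (theorem-only; no definitions, no `Prop` facts; axioms standard):
* §1 the shell profiles `ψ_n(y) = yⁿ·χ^{(n)}(1,y)`: smooth, supported in `|y| ≤ 1`, all derivatives bounded (`exists_bound_iteratedDeriv_psi`);
* §2 the commutation `∂ⁿ_A ∂^m_t = ∂^m_t ∂ⁿ_A` for `χ(c·p(te_k), A)` on the branch (`iteratedDeriv_mixed_comm`) and the scaled form of the
  inner field derivative (`iteratedDeriv_field_cutoff_eq`);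
* §3 **`exists_abs_mixedDeriv_cutoff_le`** (the displayed bound), `mixedDeriv_cutoff_eq_zero_of_not_mem_shell` (support, from
  `BIJ88SlotFactorsShell309`) and **`exists_abs_mixedDeriv_cutoff_le_indicator`** (bound × shell indicator in one line);
* §4 ON THE CELL'S OBJECTS — a located χ-slot `u_{b,m} = ∂_t^m χ(c_b·p(te_k), Φ_b(·))` of `BIJ88SlotMomentsGauss308.uD` with a LINEAR slot
  field: `contDiff_tDeriv_cutoff` (the profile `g_m(u) = ∂_t^m χ(c·p(te_k), u)` is smooth), the chain rules `fderiv_tDeriv_cutoff_linear_apply`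
  (`∂_w[g_m ∘ ℓ](φ) = g_m′(ℓφ)·ℓ(w)`) / `fderiv_fderiv_tDeriv_cutoff_linear_apply` (`∂_{w′}∂_w[g_m ∘ ℓ](φ) = g_m″(ℓφ)·ℓ(w′)·ℓ(w)`), and the
  costs **`exists_abs_fderiv_uD_inl_le`** (`|∂_w u_{b,m}(φ)| ≤ t^{−m}(|c_b|p(te_k))^{−1}·C·𝟙_{shell}(|Φ_b(φ)|)·|Φ_b(w)|`) and
  **`exists_abs_fderiv_fderiv_uD_inl_le`** (the second-order train vertex on one factor: `|∂_{w′}∂_w u_{b,m}(φ)| ≤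
  t^{−m}(|c_b|p(te_k))^{−2}·C·𝟙_{shell}(|Φ_b(φ)|)·|Φ_b(w′)|·|Φ_b(w)|`) — the two orders in which the vertices `∂_{C_s𝔫ℱ}`,
  `½Σ(C_sN_bC_s)_{pq}∂_p∂_q` of a train (`BIJ88TrainPieces306.trainOp`) differentiate one factor of the cube product (`BIJ88CubeProductFDeriv306.D2_obs`).
HONEST SCOPE.  Real analysis of one χ-factor; no Gaussian integration (the shell indicator is turned into `e^{−cp(te_k)²}` by
`BIJ88ChiFieldDeriv307`/`BIJ88GaussIntegration309Law`), no walk combinatorics, no (5.14.4).  The constant `C(χ,p,m,n)` is existential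
(print: *"a constant"*; the factorial growth in `n` of p. 307 is not tracked here).
-/

namespace Literature.MathematicalPhysics.QuantumFieldTheory.BalabanImbrieJaffe1984to88.BIJ88ChiMixedDerivN309

open Set Filter Topology
open scoped ContDiff
open BIJ88Sect2Statements (pLog)
open BIJ88Sect5Statements (CutoffProfile cutoff)
open BIJ88ChiTDeriv309 (pLog_eq_rpow_neg_log)
open BIJ88ChiTDerivN309 (isOpen_branch contDiffOn_inner abs_iteratedDeriv_inner_le exists_bound_iteratedDeriv_negLogRpow)

variable (χ : CutoffProfile)

/-! ## §1 The shell profiles `ψ_n(y) = yⁿ χ^{(n)}(1, y)` -/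

section Psi

/-- `ψ_n(y) = yⁿχ^{(n)}(1,y)` is smooth. [cite: BalabanImbrieJaffe1988, (5.2.3) p.278, §5.13 p.307] -/
theorem contDiff_psi (n : ℕ) : ContDiff ℝ ∞ fun y : ℝ => y ^ n * iteratedDeriv n χ.χ₁ y :=
  (contDiff_id.pow n).mul (by rw [iteratedDeriv_eq_iterate]; exact χ.smooth.iterate_deriv n)

/-- `ψ_n` vanishes above the shell: `ψ_n(y) = 0` for `|y| > 1` (χ(1,·) = 0 there, with all its derivatives).
[cite: BalabanImbrieJaffe1988, (5.2.3) p.278, §5.13 p.307] -/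
theorem psi_eq_zero_of_one_lt (n : ℕ) {y : ℝ} (hy : 1 < |y|) : y ^ n * iteratedDeriv n χ.χ₁ y = 0 := by
  rw [BIJ88ChiFieldDeriv307.iteratedDeriv_chi1_eq_zero_of_one_lt χ n hy, mul_zero]

/-- `ψ_n` has compact support (inside `|y| ≤ 1`). [cite: BalabanImbrieJaffe1988, (5.2.3) p.278, §5.13 p.307] -/
theorem hasCompactSupport_psi (n : ℕ) : HasCompactSupport fun y : ℝ => y ^ n * iteratedDeriv n χ.χ₁ y := by
  refine HasCompactSupport.intro (isCompact_closedBall (0 : ℝ) 1) fun y hy => psi_eq_zero_of_one_lt χ n ?_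
  rwa [Metric.mem_closedBall, dist_zero_right, Real.norm_eq_abs, not_le] at hy

/-- **all derivatives of `ψ_n` up to a given order are bounded by one constant** (smooth of compact support).
[cite: BalabanImbrieJaffe1988, (5.2.3) p.278, §5.13 p.307] -/
theorem exists_bound_iteratedDeriv_psi (n m : ℕ) :
    ∃ C : ℝ, 0 ≤ C ∧ ∀ i, i ≤ m → ∀ y : ℝ, |iteratedDeriv i (fun y : ℝ => y ^ n * iteratedDeriv n χ.χ₁ y) y| ≤ C := by
  obtain ⟨K, hK0, hK⟩ :=
    (BIJ88SmoothFactors5133.CbInf.of_hasCompactSupport (contDiff_psi χ n) (hasCompactSupport_psi χ n)).bound_le m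
  refine ⟨K, hK0, fun i hi y => ?_⟩
  rw [← Real.norm_eq_abs, ← norm_iteratedFDeriv_eq_norm_iteratedDeriv]
  exact hK i hi y

end Psi

/-! ## §2 Commutation of the mixed partials and the scaled inner field derivative -/

section Comm

/-- the two-variable factor `(A, s) ↦ χ(c·p(se_k), A) = χ(1, A/(c·p(se_k)))` is jointly smooth on `ℝ × branch`.
[cite: BalabanImbrieJaffe1988, (5.14.3) p.309] -/
theorem contDiffOn_cutoff_two (p c : ℝ) {ek : ℝ} (hek : 0 < ek) :
    ContDiffOn ℝ ∞ (fun q : ℝ × ℝ => cutoff χ (c * pLog p (q.2 * ek)) q.1) (univ ×ˢ {s : ℝ | 0 < s ∧ s * ek < 1}) := by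
  have hρ : ContDiffOn ℝ ∞ (fun q : ℝ × ℝ => (c * pLog p (q.2 * ek))⁻¹) (univ ×ˢ {s : ℝ | 0 < s ∧ s * ek < 1}) :=
    fun q hq => ((BIJ88SlotFactorsSmooth308.contDiffAt_inv_scale p c hek (mem_prod.1 hq).2).comp_contDiffWithinAt q
      contDiffWithinAt_snd)
  have h : ContDiffOn ℝ ∞ (fun q : ℝ × ℝ => χ.χ₁ (q.1 * (c * pLog p (q.2 * ek))⁻¹)) (univ ×ˢ {s : ℝ | 0 < s ∧ s * ek < 1}) :=
    χ.smooth.comp_contDiffOn (contDiffOn_fst.mul hρ)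
  exact h.congr fun q _ => by simp only [cutoff, div_eq_mul_inv]

/-- **`∂ⁿ_A ∂^m_t χ(c·p(te_k), A) = ∂^m_t ∂ⁿ_A χ(c·p(te_k), A)`** on the branch `0 < t`, `te_k < 1` (Schwarz's theorem for all orders,
the joint factor being smooth there). [cite: BalabanImbrieJaffe1988, §5.13 p.307, (5.14.3) p.309] -/
theorem iteratedDeriv_mixed_comm (p c : ℝ) {ek t : ℝ} (hek : 0 < ek) (ht : 0 < t) (h1 : t * ek < 1) (m n : ℕ) (A : ℝ) :
    iteratedDeriv n (fun u : ℝ => iteratedDeriv m (fun s => cutoff χ (c * pLog p (s * ek)) u) t) A =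
      iteratedDeriv m (fun s => iteratedDeriv n (fun u : ℝ => cutoff χ (c * pLog p (s * ek)) u) A) t := by
  have hU := isOpen_branch ek
  have htU : t ∈ {s : ℝ | 0 < s ∧ s * ek < 1} := ⟨ht, h1⟩
  have hcomm := Literature.Analysis.Calculus.iteratedDeriv_iteratedDerivWithin_comm (𝕂 := ℝ) (G := ℝ)
    (Φ := fun q : ℝ × ℝ => cutoff χ (c * pLog p (q.2 * ek)) q.1) (I := {s : ℝ | 0 < s ∧ s * ek < 1}) (n := ∞)
    (contDiffOn_cutoff_two χ p c hek) hU.uniqueDiffOn (α := n) (β := m) (mod_cast le_top) A htU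
    (by rw [hU.interior_eq]; exact subset_closure htU)
  have hL : (fun u : ℝ => iteratedDerivWithin m (fun s => cutoff χ (c * pLog p (s * ek)) u) {s : ℝ | 0 < s ∧ s * ek < 1} t) =
      fun u => iteratedDeriv m (fun s => cutoff χ (c * pLog p (s * ek)) u) t :=
    funext fun u => iteratedDerivWithin_of_isOpen hU htU
  rw [hL, iteratedDerivWithin_of_isOpen hU htU] at hcomm
  exact hcomm

/-- the inner field derivative by scaling: `∂ⁿ_A χ(q, A) = q^{−n} χ^{(n)}(1, A/q)` at `q = c·p(se_k)`.
[cite: BalabanImbrieJaffe1988, (5.2.4) p.278, §5.13 p.307] -/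
theorem iteratedDeriv_field_cutoff_eq (p c ek s : ℝ) (n : ℕ) (A : ℝ) :
    iteratedDeriv n (fun u : ℝ => cutoff χ (c * pLog p (s * ek)) u) A =
      (c * pLog p (s * ek))⁻¹ ^ n * iteratedDeriv n χ.χ₁ (A / (c * pLog p (s * ek))) := by
  have h := BIJ88ChiFieldDeriv307.iteratedDeriv_cutoff χ (c * pLog p (s * ek)) n
  exact congrFun h A

/-- on the shell (`A ≠ 0`) the scaled inner derivative is `A^{−n} ψ_n(A/q)`: `q^{−n}χ^{(n)}(1,A/q) = A^{−n}·(A/q)ⁿχ^{(n)}(1,A/q)`.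
[cite: BalabanImbrieJaffe1988, (5.2.4) p.278, §5.13 p.307] -/
theorem scaled_eq_psi {A : ℝ} (hA : A ≠ 0) (q : ℝ) (n : ℕ) :
    q⁻¹ ^ n * iteratedDeriv n χ.χ₁ (A / q) = A⁻¹ ^ n * ((A / q) ^ n * iteratedDeriv n χ.χ₁ (A / q)) := by
  rw [← mul_assoc, div_pow]
  simp only [inv_pow]
  rw [← mul_div_assoc, inv_mul_cancel₀ (pow_ne_zero n hA), one_div]

end Comm

/-! ## §3 The mixed-derivative bound and its shell support -/

section Main

/-- the t-differentiated χ-factor in the `χ(1, u·ρ(s))` form of `BIJ88SlotFactorsSmooth308`/`BIJ88SlotFactorsShell309`, `ρ(s) = (c·p(se_k))⁻¹`.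
[cite: BalabanImbrieJaffe1988, (5.2.4) p.278, (5.14.3) p.309] -/
theorem tDeriv_cutoff_eq_chi1_mul (p c ek t : ℝ) (m : ℕ) :
    (fun u : ℝ => iteratedDeriv m (fun s => cutoff χ (c * pLog p (s * ek)) u) t) =
      fun u => iteratedDeriv m (fun σ => χ.χ₁ (u * (c * pLog p (σ * ek))⁻¹)) t := by
  funext u; simp only [cutoff, div_eq_mul_inv]

/-- **support**: for `(m,n) ≠ (0,0)` the mixed derivative vanishes at every `A` off the shell `(9/10)|c|p(te_k) ≤ |A| ≤ |c|p(te_k)`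
(χ = 1 below, χ = 0 above: p. 309 *"supported in c₁p(te_k) ≤ |A^{(k)}| ≤ c₂p(te_k)"*, p. 307 *"These derivatives are supported at
|A^{(k)″}| ≥ cp(e_k)"*; from `BIJ88SlotFactorsShell309`). [cite: BalabanImbrieJaffe1988, §5.13 p.307, (5.14.3)–(5.14.4) p.309] -/
theorem mixedDeriv_cutoff_eq_zero_of_not_mem_shell (p : ℝ) {m n : ℕ} (hmn : m ≠ 0 ∨ n ≠ 0) {A c ek t : ℝ} (hc : c ≠ 0)
    (hek : 0 < ek) (ht : 0 < t) (h1 : t * ek < 1)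
    (hA : |A| ∉ Set.Icc (9 / 10 * (|c| * pLog p (t * ek))) (|c| * pLog p (t * ek))) :
    iteratedDeriv n (fun u : ℝ => iteratedDeriv m (fun s => cutoff χ (c * pLog p (s * ek)) u) t) A = 0 := by
  have htek : 0 < t * ek := mul_pos ht hek
  have hL : 0 < -Real.log (t * ek) := by have := Real.log_neg htek h1; linarith
  have hP : 0 < pLog p (t * ek) := by rw [pLog_eq_rpow_neg_log p htek h1]; exact Real.rpow_pos_of_pos hL p
  have hq : 0 < |c| * pLog p (t * ek) := mul_pos (abs_pos.2 hc) hP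
  have hρ : ContinuousAt (fun σ => (c * pLog p (σ * ek))⁻¹) t :=
    (BIJ88SlotFactorsSmooth308.contDiffAt_inv_scale p c hek ⟨ht, h1⟩).continuousAt
  have habs : |A * (c * pLog p (t * ek))⁻¹| = |A| / (|c| * pLog p (t * ek)) := by
    rw [abs_mul, abs_inv, abs_mul, abs_of_pos hP, div_eq_mul_inv]
  rw [tDeriv_cutoff_eq_chi1_mul]
  rw [Set.mem_Icc, not_and_or, not_le, not_le] at hA
  rcases hA with hlt | hgt
  · exact BIJ88SlotFactorsShell309.iteratedDeriv_iteratedDeriv_chi1_mul_eq_zero_of_lt χ hmn hρ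
      (by rwa [habs, div_lt_iff₀ hq])
  · exact BIJ88SlotFactorsShell309.iteratedDeriv_iteratedDeriv_chi1_mul_eq_zero_of_gt χ m n hρ
      (by rwa [habs, lt_div_iff₀ hq, one_mul])

/-- **THE SIZE OF A MIXED DERIVATIVE** (p. 309 × p. 307): for every profile χ of (5.2.3), exponent `p` of (2.33) and orders `m, n` there is
`C = C(χ,p,m,n) ≥ 0` such that for all real `A`, `c ≠ 0`, `0 < e_k`, `0 < t` with `te_k ≤ e^{−1}`:
`|∂ⁿ_A ∂^m_t χ(c·p(te_k), A)| ≤ C · t^{−m} · (|c|·p(te_k))^{−n}` — one `t^{−1}` per t-derivative (*"bounded by t^{−n} times a function bounded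
by a constant"*) and one inverse threshold per field derivative (*"Functional derivatives hitting χ-factors"*, scaling (5.2.4)).
[cite: BalabanImbrieJaffe1988, §5.13 p.307, (5.14.3)–(5.14.4) p.309] -/
theorem exists_abs_mixedDeriv_cutoff_le (p : ℝ) (m n : ℕ) :
    ∃ C : ℝ, 0 ≤ C ∧ ∀ (A : ℝ) ⦃c ek t : ℝ⦄, c ≠ 0 → 0 < ek → 0 < t → t * ek ≤ Real.exp (-1) →
      |iteratedDeriv n (fun u : ℝ => iteratedDeriv m (fun s => cutoff χ (c * pLog p (s * ek)) u) t) A| ≤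
        C * t ^ (-(m : ℤ)) * (|c| * pLog p (t * ek))⁻¹ ^ n := by
  rcases Nat.eq_zero_or_pos n with hn0 | hn
  · -- no field derivative: the p. 309 sentence of `BIJ88ChiTDerivN309`
    subst hn0
    obtain ⟨C, hC0, hC⟩ := BIJ88ChiTDerivN309.exists_abs_iteratedDeriv_cutoff_t_le χ p m
    refine ⟨C, hC0, fun A c ek t hc hek ht h1 => ?_⟩
    rw [iteratedDeriv_zero, pow_zero, mul_one]
    exact hC A hc hek ht h1
  -- constants: M_i for the inner derivatives, C_ψ for the derivatives of ψ_n
  choose M hM0 hM using fun i => exists_bound_iteratedDeriv_negLogRpow p i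
  obtain ⟨Cψ, hCψ0, hCψ⟩ := exists_bound_iteratedDeriv_psi χ n m
  set D₀ : ℝ := 1 + ∑ i ∈ Finset.range (m + 1), M i with hD₀
  have hD₀1 : 1 ≤ D₀ := by
    have : 0 ≤ ∑ i ∈ Finset.range (m + 1), M i := Finset.sum_nonneg fun i _ => hM0 i
    linarith
  have hMD : ∀ i, i ≤ m → M i ≤ D₀ := fun i hi => by
    have := Finset.single_le_sum (fun j _ => hM0 j) (Finset.mem_range.mpr (Nat.lt_succ_of_le hi))
    linarith
  refine ⟨(10 / 9) ^ n * (m.factorial * Cψ * D₀ ^ m), by positivity, ?_⟩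
  intro A c ek t hc hek ht h1
  have htek : 0 < t * ek := mul_pos ht hek
  have h1' : t * ek < 1 := h1.trans_lt (by rw [← Real.exp_zero]; exact Real.exp_lt_exp.mpr (by norm_num))
  have hL : 0 < -Real.log (t * ek) := by have := Real.log_neg htek h1'; linarith
  have hP : 0 < pLog p (t * ek) := by rw [pLog_eq_rpow_neg_log p htek h1']; exact Real.rpow_pos_of_pos hL p
  have hq : 0 < |c| * pLog p (t * ek) := mul_pos (abs_pos.2 hc) hP
  -- off the shell the mixed derivative vanishes
  by_cases hsh : |A| ∈ Set.Icc (9 / 10 * (|c| * pLog p (t * ek))) (|c| * pLog p (t * ek))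
  swap
  · rw [mixedDeriv_cutoff_eq_zero_of_not_mem_shell χ p (Or.inr hn.ne') hc hek ht h1' hsh, abs_zero]
    positivity
  -- on the shell: `A ≠ 0`, `|A|⁻¹ ≤ (10/9)(|c|p(te_k))⁻¹`, `|A/(c·p(te_k))| ≤ 1`
  obtain ⟨hlo, hhi⟩ := hsh
  have hAq : |A / (c * pLog p (t * ek))| ≤ 1 := by rwa [abs_div, abs_mul, abs_of_pos hP, div_le_one hq]
  have hA0 : A ≠ 0 := abs_pos.1 (lt_of_lt_of_le (by positivity) hlo)
  have hAinv : |A|⁻¹ ≤ 10 / 9 * (|c| * pLog p (t * ek))⁻¹ :=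
    (inv_anti₀ (by positivity) hlo).trans_eq (by rw [mul_inv]; norm_num)
  -- swap, scale, and pull out `A^{−n}`
  rw [iteratedDeriv_mixed_comm χ p c hek ht h1' m n A]
  have hin : (fun s => iteratedDeriv n (fun u : ℝ => cutoff χ (c * pLog p (s * ek)) u) A) =
      fun s => A⁻¹ ^ n * ((fun y : ℝ => y ^ n * iteratedDeriv n χ.χ₁ y) ∘ fun s => A / (c * pLog p (s * ek))) s := by
    funext s
    rw [iteratedDeriv_field_cutoff_eq, scaled_eq_psi χ hA0]
    rfl
  rw [hin, iteratedDeriv_const_mul_field, abs_mul, abs_pow, abs_inv]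
  -- Faà di Bruno on the branch for `s ↦ ψ_n(A/(c·p(se_k)))`
  have hD : ∀ i, 1 ≤ i → i ≤ m → ‖iteratedDeriv i (fun s => A / (c * pLog p (s * ek))) t‖ ≤ (D₀ / t) ^ i := by
    intro i _ hi
    rw [Real.norm_eq_abs]
    refine (abs_iteratedDeriv_inner_le p i (hM i) A hek ht h1).trans ?_
    rw [div_pow, div_eq_mul_inv, zpow_neg, zpow_natCast]
    have hti : 0 < (t ^ i)⁻¹ := inv_pos.mpr (pow_pos ht _)
    calc M i * (t ^ i)⁻¹ * |A / (c * pLog p (t * ek))|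
        ≤ M i * (t ^ i)⁻¹ * 1 := mul_le_mul_of_nonneg_left hAq (mul_nonneg (hM0 i) hti.le)
      _ ≤ D₀ ^ i * (t ^ i)⁻¹ := by
          rw [mul_one]
          exact mul_le_mul_of_nonneg_right ((hMD i hi).trans (le_self_pow₀ hD₀1 (by omega))) hti.le
  have hC' : ∀ i, i ≤ m → ‖iteratedDeriv i (fun y : ℝ => y ^ n * iteratedDeriv n χ.χ₁ y) (A / (c * pLog p (t * ek)))‖ ≤ Cψ :=
    fun i hi => by rw [Real.norm_eq_abs]; exact hCψ i hi _
  have key := Literature.Analysis.Calculus.norm_iteratedDeriv_comp_le_of_contDiffOn (isOpen_branch ek) ⟨ht, h1'⟩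
    ((contDiff_psi χ n).of_le (mod_cast le_top)) (contDiffOn_inner p A c hek m) hC' hD
  rw [Real.norm_eq_abs] at key
  have hkey : |iteratedDeriv m ((fun y : ℝ => y ^ n * iteratedDeriv n χ.χ₁ y) ∘ fun s => A / (c * pLog p (s * ek))) t| ≤
      m.factorial * Cψ * D₀ ^ m * t ^ (-(m : ℤ)) := by
    refine key.trans (le_of_eq ?_)
    rw [div_pow, zpow_neg, zpow_natCast, div_eq_mul_inv]
    ring
  calc |A|⁻¹ ^ n * |iteratedDeriv m ((fun y : ℝ => y ^ n * iteratedDeriv n χ.χ₁ y) ∘ fun s => A / (c * pLog p (s * ek))) t|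
      ≤ (10 / 9 * (|c| * pLog p (t * ek))⁻¹) ^ n * (m.factorial * Cψ * D₀ ^ m * t ^ (-(m : ℤ))) :=
        mul_le_mul (pow_le_pow_left₀ (inv_nonneg.2 (abs_nonneg A)) hAinv n) hkey (abs_nonneg _) (by positivity)
    _ = (10 / 9) ^ n * (m.factorial * Cψ * D₀ ^ m) * t ^ (-(m : ℤ)) * (|c| * pLog p (t * ek))⁻¹ ^ n := by
        rw [mul_pow]; ring

/-- **THE TWO PRINTED SENTENCES IN ONE LINE** (p. 309 *"bounded by t^{−n} times a function bounded by a constant and supported in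
c₁p(te_k) ≤ |A^{(k)}| ≤ c₂p(te_k)"*; p. 307 *"Functional derivatives hitting χ-factors … These derivatives are supported at |A^{(k)″}| ≥
cp(e_k)"*): for `(m,n) ≠ (0,0)` there is `C = C(χ,p,m,n) ≥ 0` with
`|∂ⁿ_A ∂^m_t χ(c·p(te_k), A)| ≤ t^{−m} · (|c|p(te_k))^{−n} · C · 𝟙_{[(9/10)|c|p(te_k), |c|p(te_k)]}(|A|)`
for all real `A`, `c ≠ 0`, `0 < e_k`, `0 < t`, `te_k ≤ e^{−1}`. [cite: BalabanImbrieJaffe1988, §5.13 p.307, (5.14.3)–(5.14.4) p.309] -/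
theorem exists_abs_mixedDeriv_cutoff_le_indicator (p : ℝ) {m n : ℕ} (hmn : m ≠ 0 ∨ n ≠ 0) :
    ∃ C : ℝ, 0 ≤ C ∧ ∀ (A : ℝ) ⦃c ek t : ℝ⦄, c ≠ 0 → 0 < ek → 0 < t → t * ek ≤ Real.exp (-1) →
      |iteratedDeriv n (fun u : ℝ => iteratedDeriv m (fun s => cutoff χ (c * pLog p (s * ek)) u) t) A| ≤
        t ^ (-(m : ℤ)) * (|c| * pLog p (t * ek))⁻¹ ^ n *
          (C * Set.indicator (Set.Icc (9 / 10 * (|c| * pLog p (t * ek))) (|c| * pLog p (t * ek))) (fun _ => (1 : ℝ)) |A|) := by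
  obtain ⟨C, hC0, hC⟩ := exists_abs_mixedDeriv_cutoff_le χ p m n
  refine ⟨C, hC0, fun A c ek t hc hek ht h1 => ?_⟩
  by_cases hA : |A| ∈ Set.Icc (9 / 10 * (|c| * pLog p (t * ek))) (|c| * pLog p (t * ek))
  · rw [Set.indicator_of_mem hA, mul_one]
    calc _ ≤ C * t ^ (-(m : ℤ)) * (|c| * pLog p (t * ek))⁻¹ ^ n := hC A hc hek ht h1
      _ = _ := by ring
  · have h1' : t * ek < 1 := h1.trans_lt (by rw [← Real.exp_zero]; exact Real.exp_lt_exp.mpr (by norm_num))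
    rw [Set.indicator_of_notMem hA, mul_zero, mul_zero, mixedDeriv_cutoff_eq_zero_of_not_mem_shell χ p hmn hc hek ht h1' hA, abs_zero]

end Main

/-! ## §4 On the cell's objects: the field derivatives of a located χ-slot with a linear slot field -/

section Slots

/-- the one-variable profile `g_m(u) = ∂_t^m χ(c·p(te_k), u)` of a located χ-slot is smooth in `u` (`t` on the branch).
[cite: BalabanImbrieJaffe1988, (5.14.3) p.309] -/
theorem contDiff_tDeriv_cutoff (p c : ℝ) {ek t : ℝ} (hek : 0 < ek) (ht : 0 < t) (h1 : t * ek < 1) (m : ℕ) :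
    ContDiff ℝ ∞ fun u : ℝ => iteratedDeriv m (fun s => cutoff χ (c * pLog p (s * ek)) u) t := by
  have h := BIJ88SlotFactorsSmooth308.contDiff_iteratedDeriv_chi1_mul χ (isOpen_branch ek)
    (fun s hs => BIJ88SlotFactorsSmooth308.contDiffAt_inv_scale p c hek hs) m (t := t) ⟨ht, h1⟩
  rw [tDeriv_cutoff_eq_chi1_mul]; exact h

variable {α : Type} [Fintype α]

/-- **first field derivative of a located χ-slot** (linear slot field `ℓ`): along any direction `w`,
`∂_w [∂_t^m χ(c·p(te_k), ℓ(·))](φ) = g_m′(ℓ(φ)) · ℓ(w)` — the chain rule behind *"Functional derivatives hitting χ-factors"*.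
[cite: BalabanImbrieJaffe1988, §5.13 p.307, (5.14.3) p.309] -/
theorem fderiv_tDeriv_cutoff_linear_apply (p c : ℝ) {ek t : ℝ} (hek : 0 < ek) (ht : 0 < t) (h1 : t * ek < 1) (m : ℕ)
    {ℓ : (α → ℝ) → ℝ} (hℓ : IsLinearMap ℝ ℓ) (φ w : α → ℝ) :
    fderiv ℝ (fun ψ : α → ℝ => iteratedDeriv m (fun s => cutoff χ (c * pLog p (s * ek)) (ℓ ψ)) t) φ w =
      iteratedDeriv 1 (fun u : ℝ => iteratedDeriv m (fun s => cutoff χ (c * pLog p (s * ek)) u) t) (ℓ φ) * ℓ w := by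
  set g : ℝ → ℝ := fun u => iteratedDeriv m (fun s => cutoff χ (c * pLog p (s * ek)) u) t with hg
  have hgd : Differentiable ℝ g := (contDiff_tDeriv_cutoff χ p c hek ht h1 m).differentiable (by simp)
  set L : (α → ℝ) →L[ℝ] ℝ := LinearMap.toContinuousLinearMap (IsLinearMap.mk' ℓ hℓ) with hL
  have hLapp : ∀ ψ, L ψ = ℓ ψ := fun ψ => rfl
  have hcomp : HasFDerivAt (g ∘ L) (deriv g (L φ) • L) φ := (hgd _).hasDerivAt.comp_hasFDerivAt φ L.hasFDerivAt
  have hfun : (fun ψ : α → ℝ => iteratedDeriv m (fun s => cutoff χ (c * pLog p (s * ek)) (ℓ ψ)) t) = g ∘ L := rfl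
  rw [hfun, hcomp.fderiv, iteratedDeriv_one]
  rfl

/-- **second field derivative of a located χ-slot** (linear slot field `ℓ`): `∂_{w′}∂_w [∂_t^m χ(c·p(te_k), ℓ(·))](φ) =
g_m″(ℓ(φ)) · ℓ(w′) · ℓ(w)` — the order the train vertex `½Σ(C_sN_bC_s)_{pq}∂_p∂_q` applies to one factor (p. 307: *"Factorials can
be produced when many functional derivatives hit the same object, for example a characteristic function"*).
[cite: BalabanImbrieJaffe1988, §5.13 p.307, (5.14.3) p.309] -/
theorem fderiv_fderiv_tDeriv_cutoff_linear_apply (p c : ℝ) {ek t : ℝ} (hek : 0 < ek) (ht : 0 < t) (h1 : t * ek < 1) (m : ℕ)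
    {ℓ : (α → ℝ) → ℝ} (hℓ : IsLinearMap ℝ ℓ) (φ w w' : α → ℝ) :
    fderiv ℝ (fun ψ' : α → ℝ => fderiv ℝ (fun ψ : α → ℝ => iteratedDeriv m (fun s => cutoff χ (c * pLog p (s * ek)) (ℓ ψ)) t) ψ' w)
        φ w' =
      iteratedDeriv 2 (fun u : ℝ => iteratedDeriv m (fun s => cutoff χ (c * pLog p (s * ek)) u) t) (ℓ φ) * ℓ w' * ℓ w := by
  set g : ℝ → ℝ := fun u => iteratedDeriv m (fun s => cutoff χ (c * pLog p (s * ek)) u) t with hg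
  have hgc := contDiff_tDeriv_cutoff χ p c hek ht h1 m
  have hg1d : Differentiable ℝ (iteratedDeriv 1 g) := by
    rw [iteratedDeriv_eq_iterate]; exact (hgc.iterate_deriv 1).differentiable (by simp)
  set L : (α → ℝ) →L[ℝ] ℝ := LinearMap.toContinuousLinearMap (IsLinearMap.mk' ℓ hℓ) with hL
  have h1st : (fun ψ' : α → ℝ => fderiv ℝ (fun ψ : α → ℝ => iteratedDeriv m (fun s => cutoff χ (c * pLog p (s * ek)) (ℓ ψ)) t) ψ' w)
      = fun ψ' => (iteratedDeriv 1 g ∘ L) ψ' * ℓ w :=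
    funext fun ψ' => fderiv_tDeriv_cutoff_linear_apply χ p c hek ht h1 m hℓ ψ' w
  have hcomp : HasFDerivAt (iteratedDeriv 1 g ∘ L) (deriv (iteratedDeriv 1 g) (L φ) • L) φ :=
    (hg1d _).hasDerivAt.comp_hasFDerivAt φ L.hasFDerivAt
  have h2 : iteratedDeriv 2 g = deriv (iteratedDeriv 1 g) := iteratedDeriv_succ
  have key : (ℓ w • (deriv (iteratedDeriv 1 g) (L φ) • L)) w' = iteratedDeriv 2 g (ℓ φ) * ℓ w' * ℓ w := by
    rw [h2]
    simp only [_root_.smul_apply, smul_eq_mul]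
    show ℓ w * (deriv (iteratedDeriv 1 g) (ℓ φ) * ℓ w') = deriv (iteratedDeriv 1 g) (ℓ φ) * ℓ w' * ℓ w
    ring
  rw [h1st, fderiv_mul_const (hcomp.differentiableAt), hcomp.fderiv]
  exact key

variable {ι υ : Type} (p : ℝ) (B : Finset ι) {Φ : ι → (α → ℝ) → ℝ} {c : ι → ℝ} (Ys : Finset υ) {V : υ → (α → ℝ) → ℝ}

/-- **THE COST OF ONE FUNCTIONAL DERIVATIVE ON A LOCATED χ-SLOT** (p. 307 × p. 309 on the cell's objects): for the slot factor
`u_{b,m} = ∂_t^m χ(c_b·p(te_k), Φ_b(·))` of `BIJ88SlotMomentsGauss308.uD` with a linear slot field `Φ_b`, `c_b ≠ 0`, and every order `m`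
there is `C = C(χ,p,m) ≥ 0` with, for all fields `φ`, directions `w`, `0 < e_k`, `0 < t`, `te_k ≤ e^{−1}`:
`|∂_w u_{b,m}(φ)| ≤ t^{−m} · (|c_b|p(te_k))^{−1} · C · 𝟙_{[(9/10)|c_b|p(te_k), |c_b|p(te_k)]}(|Φ_b(φ)|) · |Φ_b(w)|`.
[cite: BalabanImbrieJaffe1988, §5.13 p.307, (5.14.3)–(5.14.4) p.309] -/
theorem exists_abs_fderiv_uD_inl_le (m : ℕ) :
    ∃ C : ℝ, 0 ≤ C ∧ ∀ (b : ↥B), c b ≠ 0 → IsLinearMap ℝ (Φ b) → ∀ (φ w : α → ℝ) ⦃ek t : ℝ⦄, 0 < ek → 0 < t →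
      t * ek ≤ Real.exp (-1) →
        |fderiv ℝ (BIJ88SlotMomentsGauss308.uD χ p ek B Φ c Ys V t (Sum.inl b) m) φ w| ≤
          t ^ (-(m : ℤ)) * (|c b| * pLog p (t * ek))⁻¹ *
            (C * Set.indicator (Set.Icc (9 / 10 * (|c b| * pLog p (t * ek))) (|c b| * pLog p (t * ek))) (fun _ => (1 : ℝ))
              |Φ b φ|) * |Φ b w| := by
  obtain ⟨C, hC0, hC⟩ := exists_abs_mixedDeriv_cutoff_le_indicator χ p (m := m) (n := 1) (Or.inr one_ne_zero)
  refine ⟨C, hC0, fun b hcb hΦ φ w ek t hek ht h1 => ?_⟩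
  have h1' : t * ek < 1 := h1.trans_lt (by rw [← Real.exp_zero]; exact Real.exp_lt_exp.mpr (by norm_num))
  have hfd := fderiv_tDeriv_cutoff_linear_apply χ p (c b) hek ht h1' m hΦ φ w
  rw [show BIJ88SlotMomentsGauss308.uD χ p ek B Φ c Ys V t (Sum.inl b) m =
      fun ψ : α → ℝ => iteratedDeriv m (fun s => cutoff χ (c b * pLog p (s * ek)) (Φ b ψ)) t from rfl, hfd, abs_mul]
  refine mul_le_mul_of_nonneg_right ?_ (abs_nonneg _)
  simpa only [pow_one] using hC (Φ b φ) hcb hek ht h1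

/-- **THE COST OF THE SECOND-ORDER TRAIN VERTEX ON ONE LOCATED χ-SLOT**: with `C = C(χ,p,m) ≥ 0`,
`|∂_{w′}∂_w u_{b,m}(φ)| ≤ t^{−m} · (|c_b|p(te_k))^{−2} · C · 𝟙_{[(9/10)|c_b|p(te_k), |c_b|p(te_k)]}(|Φ_b(φ)|) · |Φ_b(w′)| · |Φ_b(w)|`
(linear slot field, `c_b ≠ 0`, `0 < e_k`, `0 < t`, `te_k ≤ e^{−1}`). [cite: BalabanImbrieJaffe1988, §5.13 p.307, (5.14.3)–(5.14.4) p.309] -/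
theorem exists_abs_fderiv_fderiv_uD_inl_le (m : ℕ) :
    ∃ C : ℝ, 0 ≤ C ∧ ∀ (b : ↥B), c b ≠ 0 → IsLinearMap ℝ (Φ b) → ∀ (φ w w' : α → ℝ) ⦃ek t : ℝ⦄, 0 < ek → 0 < t →
      t * ek ≤ Real.exp (-1) →
        |fderiv ℝ (fun ψ' => fderiv ℝ (BIJ88SlotMomentsGauss308.uD χ p ek B Φ c Ys V t (Sum.inl b) m) ψ' w) φ w'| ≤
          t ^ (-(m : ℤ)) * (|c b| * pLog p (t * ek))⁻¹ ^ 2 *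
            (C * Set.indicator (Set.Icc (9 / 10 * (|c b| * pLog p (t * ek))) (|c b| * pLog p (t * ek))) (fun _ => (1 : ℝ))
              |Φ b φ|) * |Φ b w'| * |Φ b w| := by
  obtain ⟨C, hC0, hC⟩ := exists_abs_mixedDeriv_cutoff_le_indicator χ p (m := m) (n := 2) (Or.inr two_ne_zero)
  refine ⟨C, hC0, fun b hcb hΦ φ w w' ek t hek ht h1 => ?_⟩
  have h1' : t * ek < 1 := h1.trans_lt (by rw [← Real.exp_zero]; exact Real.exp_lt_exp.mpr (by norm_num))
  have hfd := fderiv_fderiv_tDeriv_cutoff_linear_apply χ p (c b) hek ht h1' m hΦ φ w w'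
  rw [show BIJ88SlotMomentsGauss308.uD χ p ek B Φ c Ys V t (Sum.inl b) m =
      fun ψ : α → ℝ => iteratedDeriv m (fun s => cutoff χ (c b * pLog p (s * ek)) (Φ b ψ)) t from rfl, hfd, abs_mul, abs_mul]
  refine mul_le_mul_of_nonneg_right (mul_le_mul_of_nonneg_right ?_ (abs_nonneg _)) (abs_nonneg _)
  exact hC (Φ b φ) hcb hek ht h1

end Slots

end Literature.MathematicalPhysics.QuantumFieldTheory.BalabanImbrieJaffe1984to88.BIJ88ChiMixedDerivN309
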